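import Mathlib
import Summits.MatrixMultiplication.MatrixMultiplication.Theorems.AbelianSTPPSieveVP
import Summits.MatrixMultiplication.MatrixMultiplication.Theorems.AbelianSTPPCensusVPHereditary
import Summits.MatrixMultiplication.MatrixMultiplication.Theorems.AbelianSTPPCensusShapeCertFinal

/-!
# The Grynkiewicz-free PRIME-ORDER rung, range `M ≤ 127`: Pollard's rule alone finishes the vM census at prime orders

By-product of the vP census (cell mm-stpp, planner gen 7, kit j249544 «stage D3»): at PRIME orders the rule set
vM + U11-P (+ the U11-P budget bound, `VPBudget.u11P_budget_core`) — whose only additive input is Pollard's theorem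
(`Literature.Combinatorics.Additive.pollard`, in the tree) — excludes every T_E-beating shape list at every prime `p ≤ 509`
(FEASIBLE from 521).  This file proves the `M ≤ 127` part from tree theorems only, sorry-free:
`shapeExclusionVMP_prime_upTo_127 : ∀ N M a b c, 2 ≤ N → M ≤ 127 → M.Prime → SieveAdmissible M a b c → U11P M a b c → ¬ Beats (5/2) M a b c`.
Proof: the vM certificate `shapeExclusionTE_holds` (p414236) leaves residual lists only at `M ∈ {111,120,121,124,125,126,127}`;
the only prime there is 127, whose single residual list `(4,4,4)⁴` violates U11-P form B at `t = 5` (`5·min(127,123) = 615 >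
571 = UB_B(5)`); U11-P passes to the bare residual list by `VPRules.u11P_comp` (p416879).  No Grynkiewicz/Kneser input.
WHAT THIS IS NOT: not the range 128–509 (certificate, engine-decided only), no group-level statement (compose with
`STPPRepCount.u11PSound` + `AbelianTECensus.sieveSound`), no ω statement.
-/

-- single-conjunct summit: the mandated namespace repeats `MatrixMultiplication`.
set_option linter.dupNamespace false

namespace Summit.MatrixMultiplication.MatrixMultiplication.Theorems

namespace AbelianSTPPCensusVMP

open Finset

/-- A form-B violation of rule U11-P at one admissible `t ≥ 1` kills the list. -/
theorem not_u11P_of_formB_violation {K : ℕ} (M t : ℕ) (a b c : Fin K → ℕ) (h1 : 1 ≤ t)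
    (hab : t ≤ pAB a b c) (hbc : t ≤ pBC a b c)
    (hviol : ubB M a b c t < t * min M (pAB a b c + pBC a b c - t)) : ¬ U11P M a b c := by
  intro h
  have := h.1 t h1 hab hbc
  omega

/-- From a residual sub-multiset pinned by `HasSubShapes` and U11-P on the whole (packed) list to U11-P on the bare residual list. -/
theorem false_of_hasSubShapes {N : ℕ} {M : ℕ} {a b c : Fin N → ℕ} (L : List (ℕ × ℕ × ℕ))
    (hS : SieveAdmissible M a b c) (hP : U11P M a b c) (hs : HasSubShapes a b c L)
    (hdead : ¬ U11P M (fun r => (L.get r).1) (fun r => (L.get r).2.1) (fun r => (L.get r).2.2)) : False := by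
  obtain ⟨φ, hφ⟩ := hs
  have hU2 := hS.2.2.1
  have hsub := VPRules.u11P_comp φ hU2.1 hU2.2.1 hU2.2.2 hP
  have ha : (a ∘ φ) = fun r => (L.get r).1 := funext fun r => by
    have := congrArg Prod.fst (hφ r); simpa using this
  have hb : (b ∘ φ) = fun r => (L.get r).2.1 := funext fun r => by
    have := congrArg (fun p : ℕ × ℕ × ℕ => p.2.1) (hφ r); simpa using this
  have hc : (c ∘ φ) = fun r => (L.get r).2.2 := funext fun r => by
    have := congrArg (fun p : ℕ × ℕ × ℕ => p.2.2) (hφ r); simpa using this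
  rw [ha, hb, hc] at hsub
  exact hdead hsub

/-- The residual list `(4,4,4)⁴` of the T_E/127 census is U11-P-dead at the prime order 127 (form B, `t = 5`). -/
theorem dead_4444_127 :
    ¬ U11P 127 (fun r => (([(4,4,4),(4,4,4),(4,4,4),(4,4,4)] : List (ℕ × ℕ × ℕ)).get r).1)
    (fun r => (([(4,4,4),(4,4,4),(4,4,4),(4,4,4)] : List (ℕ × ℕ × ℕ)).get r).2.1)
    (fun r => (([(4,4,4),(4,4,4),(4,4,4),(4,4,4)] : List (ℕ × ℕ × ℕ)).get r).2.2) :=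
  not_u11P_of_formB_violation 127 5 _ _ _ (by decide) (by decide) (by decide) (by decide)

/-- **Prime-order rung, range `M ≤ 127`** (Grynkiewicz-free): a vM-admissible, U11-P-admissible list never beats 5/2 at a prime order ≤ 127. -/
theorem shapeExclusionVMP_prime_upTo_127 : ∀ (N M : ℕ) (a b c : Fin N → ℕ), 2 ≤ N → M ≤ 127 → M.Prime →
    SieveAdmissible M a b c → U11P M a b c → ¬ Beats (5 / 2) M a b c := by
  intro N M a b c hN hM hp hS hP hB
  rcases shapeExclusionTE_holds N M a b c hN hM hS hB with
    ⟨hM', -⟩ | ⟨hM', -⟩ | ⟨hM', -⟩ | ⟨hM', -⟩ | ⟨hM', hs⟩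
  · subst hM'; exact absurd hp (by decide)
  · rcases hM' with rfl | rfl <;> exact absurd hp (by decide)
  · subst hM'; exact absurd hp (by decide)
  · subst hM'; exact absurd hp (by decide)
  · rcases hM' with rfl | rfl
    · exact absurd hp (by decide)
    · exact false_of_hasSubShapes _ hS hP hs dead_4444_127

end AbelianSTPPCensusVMP

end Summit.MatrixMultiplication.MatrixMultiplication.Theorems
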